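import Mathlib.Tactic.IntervalCases
import Mathlib.Algebra.BigOperators.Fin
import Summits.CriticalPhenomena.PercolationContinuityZ3.Theorems.PercNearOneGluingNoHeavyLowerTailSunflowerLorentz

/-!
# `NoHeavyLowerTail` (crux stmt-CriticalPhenomena-4575), abstract sunflower cubic: LOG-SUPERMODULAR SET FUNCTIONS —
# the anti-diagonal comparison (Steps 0, 1, 3, 4, 5 of the superadditivity theorem)

Support file (seat `prim-ineq-prove-1` gen 35; `--supports stmt-CriticalPhenomena-4575`).  No `sorry`, no named facts.
Memo: run/shared/lean/prim/prim-ineq-prove-1/FINDING-LSM-prove1-g35.md §3.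

SETTING.  `f : Finset β → ℝ` NONNEGATIVE, NONDECREASING and LOG-SUPERMODULAR (`f S * f T ≤ f (S ∪ T) * f (S ∩ T)`); integer
thresholds `k k' : β → ℕ` with `k ≤ N`, `k' ≤ N`, `N ≤ k + k'`; level sets `lev k g = {i | k i ≤ g}`.
* `Psi f v = f {1 ≤ v} * f {2 ≤ v}` for `v : β → ℕ` is nondecreasing and supermodular (Step 0).
* **`sum_antidiag_le`** (Steps 1, 3, 4, 5): for every `L`,
  `∑_{g ≤ L} f (lev k g) f (lev k' (L−g)) ≤ ∑_{g ≤ L} f (lev (k+k'−N) g) f (lev N (L−g))`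
  — pointwise log-supermodularity bounds the left integrand by `Psi f` of the count vector `[k ≤ g] + [g + k' ≤ L]`, whose
  coordinate distributions along the anti-diagonal are dominated by those of the CHAIN family `[k+k'−N ≤ g] + [g+N ≤ L]`
  (same number of 2's, no fewer 0's), so the discrete Lorentz inequality `Lorentz.sum_le_sum_of_chain_of_cnt_le` applies.
The geometric (exponential) disintegration that turns this into the superadditivity of the share functional is the next file.
-/

namespace Summit.CriticalPhenomena.PercolationContinuityZ3.Theorems.SunflowerPartition

namespace LSM

open Finset

variable {β : Type*}

/-! ## Step 0: the lattice function `Psi` -/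

/-- `Psi f v = f {i | 1 ≤ v i} * f {i | 2 ≤ v i}`. [this work] -/
def Psi [Fintype β] (f : Finset β → ℝ) (v : β → ℕ) : ℝ :=
  f (univ.filter fun i => 1 ≤ v i) * f (univ.filter fun i => 2 ≤ v i)

/-- Upper level sets of a join. [this work] -/
theorem filter_le_sup [Fintype β] [DecidableEq β] (x y : β → ℕ) (t : ℕ) :
    (univ.filter fun i => t ≤ (x ⊔ y) i) = (univ.filter fun i => t ≤ x i) ∪ (univ.filter fun i => t ≤ y i) := by
  ext i; simp only [mem_filter, mem_univ, true_and, mem_union, Pi.sup_apply, le_sup_iff]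

/-- Upper level sets of a meet. [this work] -/
theorem filter_le_inf [Fintype β] [DecidableEq β] (x y : β → ℕ) (t : ℕ) :
    (univ.filter fun i => t ≤ (x ⊓ y) i) = (univ.filter fun i => t ≤ x i) ∩ (univ.filter fun i => t ≤ y i) := by
  ext i; simp only [mem_filter, mem_univ, true_and, mem_inter, Pi.inf_apply, le_inf_iff]

/-- Upper level sets are monotone. [this work] -/
theorem filter_le_mono [Fintype β] {x y : β → ℕ} (h : x ≤ y) (t : ℕ) :
    (univ.filter fun i => t ≤ x i) ⊆ (univ.filter fun i => t ≤ y i) := by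
  intro i; simp only [mem_filter, mem_univ, true_and]; exact fun hi => hi.trans (h i)

/-- `Psi f` is nondecreasing. [this work] -/
theorem Psi_mono [Fintype β] {f : Finset β → ℝ} (hf0 : ∀ S, 0 ≤ f S) (hfm : ∀ S T, S ⊆ T → f S ≤ f T) :
    Monotone (Psi f) := by
  intro x y h
  unfold Psi
  exact mul_le_mul (hfm _ _ (filter_le_mono h 1)) (hfm _ _ (filter_le_mono h 2)) (hf0 _) (hf0 _)

/-- An algebraic lemma: `0 ≤ D ≤ B`, `B, B' ≤ A` and `B B' ≤ A D` give `B + B' ≤ A + D`. [this work] -/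
theorem add_le_add_of_mul_le {A B B' D : ℝ} (hD : 0 ≤ D) (hBA : B ≤ A) (hB'A : B' ≤ A) (hDB : D ≤ B)
    (h : B * B' ≤ A * D) : B + B' ≤ A + D := by
  by_cases hA : A = 0
  · have hB : B = 0 := le_antisymm (hA ▸ hBA) (hD.trans hDB)
    have hD0 : D = 0 := le_antisymm (hB ▸ hDB) hD
    have hB' : B' ≤ 0 := hA ▸ hB'A
    nlinarith
  · have hApos : 0 < A := lt_of_le_of_ne (hD.trans (hDB.trans hBA)) (Ne.symm hA)
    nlinarith [mul_nonneg (sub_nonneg.2 hBA) (sub_nonneg.2 hB'A)]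

/-- `Psi f` is supermodular for nonnegative, nondecreasing, log-supermodular `f`. [this work] -/
theorem Psi_supermod [Fintype β] [DecidableEq β] {f : Finset β → ℝ} (hf0 : ∀ S, 0 ≤ f S)
    (hfm : ∀ S T, S ⊆ T → f S ≤ f T) (hfl : ∀ S T, f S * f T ≤ f (S ∪ T) * f (S ∩ T)) (x y : β → ℕ) :
    Psi f x + Psi f y ≤ Psi f (x ⊔ y) + Psi f (x ⊓ y) := by
  have hmono := Psi_mono hf0 hfm
  refine add_le_add_of_mul_le ?_ (hmono le_sup_left) (hmono le_sup_right) (hmono inf_le_left) ?_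
  · unfold Psi; exact mul_nonneg (hf0 _) (hf0 _)
  · unfold Psi
    rw [filter_le_sup, filter_le_sup, filter_le_inf, filter_le_inf]
    set X1 := univ.filter fun i => 1 ≤ x i; set X2 := univ.filter fun i => 2 ≤ x i
    set Y1 := univ.filter fun i => 1 ≤ y i; set Y2 := univ.filter fun i => 2 ≤ y i
    have h1 := hfl X1 Y1
    have h2 := hfl X2 Y2
    calc f X1 * f X2 * (f Y1 * f Y2) = (f X1 * f Y1) * (f X2 * f Y2) := by ring
      _ ≤ (f (X1 ∪ Y1) * f (X1 ∩ Y1)) * (f (X2 ∪ Y2) * f (X2 ∩ Y2)) :=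
          mul_le_mul h1 h2 (mul_nonneg (hf0 _) (hf0 _)) (mul_nonneg (hf0 _) (hf0 _))
      _ = f (X1 ∪ Y1) * f (X2 ∪ Y2) * (f (X1 ∩ Y1) * f (X2 ∩ Y2)) := by ring

/-! ## Level sets and the two anti-diagonal families -/

/-- Level set `{i | k i ≤ g}` of a threshold vector. [this work] -/
def lev [Fintype β] (k : β → ℕ) (g : ℕ) : Finset β := univ.filter fun i => k i ≤ g

/-- The count family of the LEFT side on the anti-diagonal `g + g' = L`: `[k ≤ g] + [g + k' ≤ L]`. [this work] -/
def nuL (k k' : β → ℕ) (L : ℕ) (g : Fin (L + 1)) (i : β) : ℕ :=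
  (if k i ≤ (g : ℕ) then 1 else 0) + (if (g : ℕ) + k' i ≤ L then 1 else 0)

/-- The count family of the RIGHT side: `[k + k' ≤ g + N] + [g + N ≤ L]` (a chain family). [this work] -/
def nuR (k k' : β → ℕ) (N L : ℕ) (g : Fin (L + 1)) (i : β) : ℕ :=
  (if k i + k' i ≤ (g : ℕ) + N then 1 else 0) + (if (g : ℕ) + N ≤ L then 1 else 0)

/-! ### Step 1: pointwise log-supermodularity on the left, exactness on the right -/

/-- `{1 ≤ nuL}` is the union of the two level sets. [this work] -/
theorem filter_one_le_nuL [Fintype β] [DecidableEq β] (k k' : β → ℕ) (L : ℕ) (g : Fin (L + 1)) :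
    (univ.filter fun i => 1 ≤ nuL k k' L g i) = lev k g ∪ lev k' (L - g) := by
  ext i
  simp only [nuL, lev, mem_filter, mem_univ, true_and, mem_union]
  have hg : (g : ℕ) ≤ L := Nat.lt_succ_iff.1 g.2
  split_ifs <;> omega

/-- `{2 ≤ nuL}` is the intersection of the two level sets. [this work] -/
theorem filter_two_le_nuL [Fintype β] [DecidableEq β] (k k' : β → ℕ) (L : ℕ) (g : Fin (L + 1)) :
    (univ.filter fun i => 2 ≤ nuL k k' L g i) = lev k g ∩ lev k' (L - g) := by
  ext i
  simp only [nuL, lev, mem_filter, mem_univ, true_and, mem_inter]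
  have hg : (g : ℕ) ≤ L := Nat.lt_succ_iff.1 g.2
  split_ifs <;> omega

/-- Step 1 (left): `f (lev k g) f (lev k' (L−g)) ≤ Psi f (nuL g)` by log-supermodularity. [this work] -/
theorem mul_le_Psi_nuL [Fintype β] [DecidableEq β] {f : Finset β → ℝ}
    (hfl : ∀ S T, f S * f T ≤ f (S ∪ T) * f (S ∩ T)) (k k' : β → ℕ) (L : ℕ) (g : Fin (L + 1)) :
    f (lev k g) * f (lev k' (L - g)) ≤ Psi f (nuL k k' L g) := by
  unfold Psi; rw [filter_one_le_nuL, filter_two_le_nuL]; exact hfl _ _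

/-- Step 1 (right): `Psi f (nuR g) = f (lev (k+k'−N) g) f (lev N (L−g))`. [this work] -/
theorem Psi_nuR_eq [Fintype β] (f : Finset β → ℝ) (k k' : β → ℕ) (N L : ℕ) (hkk' : ∀ i, N ≤ k i + k' i)
    (g : Fin (L + 1)) :
    Psi f (nuR k k' N L g) = f (lev (fun i => k i + k' i - N) g) * f (lev (fun _ => N) (L - g)) := by
  have hg : (g : ℕ) ≤ L := Nat.lt_succ_iff.1 g.2
  unfold Psi
  by_cases hN : (g : ℕ) + N ≤ L
  · have h1 : (univ.filter fun i => 1 ≤ nuR k k' N L g i) = univ := by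
      ext i; simp only [nuR, mem_filter, mem_univ, true_and, iff_true]
      split_ifs <;> omega
    have h2 : (univ.filter fun i => 2 ≤ nuR k k' N L g i) = lev (fun i => k i + k' i - N) g := by
      ext i; simp only [nuR, lev, mem_filter, mem_univ, true_and]
      have := hkk' i
      split_ifs <;> omega
    have h3 : lev (fun _ : β => N) (L - g) = univ := by
      ext i; simp only [lev, mem_filter, mem_univ, true_and, iff_true]; omega
    rw [h1, h2, h3, mul_comm]
  · have h1 : (univ.filter fun i => 1 ≤ nuR k k' N L g i) = lev (fun i => k i + k' i - N) g := by
      ext i; simp only [nuR, lev, mem_filter, mem_univ, true_and]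
      have := hkk' i
      split_ifs <;> omega
    have h2 : (univ.filter fun i => 2 ≤ nuR k k' N L g i) = ∅ := by
      ext i; simp only [nuR, mem_filter, mem_univ, true_and, notMem_empty, iff_false, not_le]
      split_ifs <;> omega
    have h3 : lev (fun _ : β => N) (L - g) = ∅ := by
      ext i; simp only [lev, mem_filter, mem_univ, true_and, notMem_empty, iff_false, not_le]; omega
    rw [h1, h2, h3]

/-! ### Step 4: the right family is a chain -/

/-- Comparability of two members of the right family, ordered case. [this work] -/
theorem nuR_chain_aux (k k' : β → ℕ) (N L : ℕ) {g g' : Fin (L + 1)} (hgg' : (g : ℕ) ≤ g') :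
    nuR k k' N L g ≤ nuR k k' N L g' ∨ nuR k k' N L g' ≤ nuR k k' N L g := by
  by_cases hd : (g' : ℕ) + N ≤ L
  · left; intro i
    simp only [nuR]
    split_ifs <;> omega
  · by_cases hd' : (g : ℕ) + N ≤ L
    · right; intro i
      simp only [nuR]
      split_ifs <;> omega
    · left; intro i
      simp only [nuR]
      split_ifs <;> omega

/-- Step 4: any two members of the right family are comparable. [this work] -/
theorem nuR_chain (k k' : β → ℕ) (N L : ℕ) (g g' : Fin (L + 1)) :
    nuR k k' N L g ≤ nuR k k' N L g' ∨ nuR k k' N L g' ≤ nuR k k' N L g := by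
  rcases le_total (g : ℕ) (g' : ℕ) with h | h
  · exact nuR_chain_aux k k' N L h
  · rcases nuR_chain_aux k k' N L (g := g') (g' := g) h with h1 | h1
    · exact Or.inr h1
    · exact Or.inl h1

/-! ### Step 3: the coordinate distributions (interval counts) -/

/-- Number of `g ≤ L` with `a ≤ g < b`. [this work] -/
theorem card_filter_Ico (L a b : ℕ) :
    (univ.filter fun g : Fin (L + 1) => a ≤ (g : ℕ) ∧ (g : ℕ) < b).card = min b (L + 1) - a := by
  rw [← Finset.card_map Fin.valEmbedding]
  have : (univ.filter fun g : Fin (L + 1) => a ≤ (g : ℕ) ∧ (g : ℕ) < b).map Fin.valEmbedding =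
      Finset.Ico a (min b (L + 1)) := by
    ext n
    simp only [mem_map, mem_filter, mem_univ, true_and, Fin.valEmbedding_apply, Finset.mem_Ico, lt_min_iff]
    constructor
    · rintro ⟨g, ⟨h1, h2⟩, rfl⟩; exact ⟨h1, h2, g.2⟩
    · rintro ⟨h1, h2, h3⟩; exact ⟨⟨n, h3⟩, ⟨h1, h2⟩, rfl⟩
  rw [this, Nat.card_Ico]

/-- `cnt` as a cardinality. [this work] -/
theorem cnt_eq_card {m : ℕ} (x : Fin m → β → ℕ) (i : β) (t : ℕ) :
    Lorentz.cnt x i t = (univ.filter fun g => t ≤ x g i).card := by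
  unfold Lorentz.cnt; rw [Finset.card_filter]

/-- Members of `nuL` with value `2` in coordinate `i`: an interval count. [this work] -/
theorem cnt_nuL_two (k k' : β → ℕ) (L : ℕ) (i : β) :
    Lorentz.cnt (nuL k k' L) i 2 = min (L + 1 - k' i) (L + 1) - k i := by
  rw [cnt_eq_card, ← card_filter_Ico L (k i) (L + 1 - k' i)]
  congr 1; ext g
  simp only [mem_filter, mem_univ, true_and, nuL]
  have hg : (g : ℕ) ≤ L := Nat.lt_succ_iff.1 g.2
  split_ifs <;> omega

/-- Members of `nuR` with value `2` in coordinate `i`: an interval count. [this work] -/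
theorem cnt_nuR_two (k k' : β → ℕ) (N L : ℕ) (i : β) (hkk' : N ≤ k i + k' i) :
    Lorentz.cnt (nuR k k' N L) i 2 = min (L + 1 - N) (L + 1) - (k i + k' i - N) := by
  rw [cnt_eq_card, ← card_filter_Ico L (k i + k' i - N) (L + 1 - N)]
  congr 1; ext g
  simp only [mem_filter, mem_univ, true_and, nuR]
  have hg : (g : ℕ) ≤ L := Nat.lt_succ_iff.1 g.2
  split_ifs <;> omega

/-- `cnt (nuL ·) i 1`, counted through the complement `{nuL = 0}`, which is an interval. [this work] -/
theorem cnt_nuL_one (k k' : β → ℕ) (L : ℕ) (i : β) :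
    Lorentz.cnt (nuL k k' L) i 1 + (min (k i) (L + 1) - (L + 1 - k' i)) = L + 1 := by
  rw [cnt_eq_card, ← card_filter_Ico L (L + 1 - k' i) (k i)]
  have hdisj : (univ.filter fun g : Fin (L + 1) => 1 ≤ nuL k k' L g i) =
      (univ.filter fun g : Fin (L + 1) => L + 1 - k' i ≤ (g : ℕ) ∧ (g : ℕ) < k i)ᶜ := by
    ext g
    simp only [mem_filter, mem_univ, true_and, mem_compl, nuL, not_and, not_lt]
    have hg : (g : ℕ) ≤ L := Nat.lt_succ_iff.1 g.2
    split_ifs <;> omega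
  rw [hdisj, Finset.card_compl, Fintype.card_fin]
  have := Finset.card_le_univ (univ.filter fun g : Fin (L + 1) => L + 1 - k' i ≤ (g : ℕ) ∧ (g : ℕ) < k i)
  rw [Fintype.card_fin] at this
  omega

/-- `cnt (nuR ·) i 1`, counted through the complement `{nuR = 0}`, which is an interval. [this work] -/
theorem cnt_nuR_one (k k' : β → ℕ) (N L : ℕ) (i : β) (hkk' : N ≤ k i + k' i) :
    Lorentz.cnt (nuR k k' N L) i 1 + (min (k i + k' i - N) (L + 1) - (L + 1 - N)) = L + 1 := by
  rw [cnt_eq_card, ← card_filter_Ico L (L + 1 - N) (k i + k' i - N)]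
  have hdisj : (univ.filter fun g : Fin (L + 1) => 1 ≤ nuR k k' N L g i) =
      (univ.filter fun g : Fin (L + 1) => L + 1 - N ≤ (g : ℕ) ∧ (g : ℕ) < k i + k' i - N)ᶜ := by
    ext g
    simp only [mem_filter, mem_univ, true_and, mem_compl, nuR, not_and, not_lt]
    have hg : (g : ℕ) ≤ L := Nat.lt_succ_iff.1 g.2
    split_ifs <;> omega
  rw [hdisj, Finset.card_compl, Fintype.card_fin]
  have := Finset.card_le_univ (univ.filter fun g : Fin (L + 1) => L + 1 - N ≤ (g : ℕ) ∧ (g : ℕ) < k i + k' i - N)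
  rw [Fintype.card_fin] at this
  omega

/-- Every member counts at level `0`. [this work] -/
theorem cnt_zero {m : ℕ} (x : Fin m → β → ℕ) (i : β) : Lorentz.cnt x i 0 = m := by
  unfold Lorentz.cnt
  simp only [Nat.zero_le, if_true, sum_const, card_univ, Fintype.card_fin, smul_eq_mul, mul_one]

/-- No member of `nuL` exceeds `2`. [this work] -/
theorem cnt_nuL_ge_three (k k' : β → ℕ) (L : ℕ) (i : β) {t : ℕ} (ht : 3 ≤ t) :
    Lorentz.cnt (nuL k k' L) i t = 0 := by
  unfold Lorentz.cnt
  refine Finset.sum_eq_zero fun g _ => ?_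
  have : nuL k k' L g i ≤ 2 := by
    unfold nuL
    split_ifs <;> omega
  rw [if_neg]; omega

/-- Step 3: along the anti-diagonal every coordinate distribution of `nuL` is dominated by that of `nuR`. [this work] -/
theorem cnt_nuL_le_cnt_nuR (k k' : β → ℕ) (N L : ℕ) (hk : ∀ i, k i ≤ N) (hk' : ∀ i, k' i ≤ N)
    (hkk' : ∀ i, N ≤ k i + k' i) (i : β) (t : ℕ) :
    Lorentz.cnt (nuL k k' L) i t ≤ Lorentz.cnt (nuR k k' N L) i t := by
  rcases Nat.lt_or_ge t 3 with ht | ht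
  · interval_cases t
    · rw [cnt_zero, cnt_zero]
    · have h1 := cnt_nuL_one k k' L i
      have h2 := cnt_nuR_one k k' N L i (hkk' i)
      have := hk i; have := hk' i; have := hkk' i
      omega
    · rw [cnt_nuL_two, cnt_nuR_two k k' N L i (hkk' i)]
      have := hk i; have := hk' i; have := hkk' i
      omega
  · rw [cnt_nuL_ge_three k k' L i ht]; exact Nat.zero_le _

/-! ### Step 5: the anti-diagonal inequality -/

/-- **The anti-diagonal comparison** (Steps 1, 3, 4, 5 of memo §3): for nonnegative, nondecreasing, log-supermodular `f` and
thresholds `k, k' ≤ N ≤ k + k'`,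
`∑_{g ≤ L} f (lev k g) f (lev k' (L−g)) ≤ ∑_{g ≤ L} f (lev (k+k'−N) g) f (lev N (L−g))`. [this work] -/
theorem sum_antidiag_le [Fintype β] [DecidableEq β] {f : Finset β → ℝ} (hf0 : ∀ S, 0 ≤ f S)
    (hfm : ∀ S T, S ⊆ T → f S ≤ f T) (hfl : ∀ S T, f S * f T ≤ f (S ∪ T) * f (S ∩ T)) (k k' : β → ℕ) (N : ℕ)
    (hk : ∀ i, k i ≤ N) (hk' : ∀ i, k' i ≤ N) (hkk' : ∀ i, N ≤ k i + k' i) (L : ℕ) :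
    ∑ g ∈ range (L + 1), f (lev k g) * f (lev k' (L - g)) ≤
      ∑ g ∈ range (L + 1), f (lev (fun i => k i + k' i - N) g) * f (lev (fun _ => N) (L - g)) := by
  rw [← Fin.sum_univ_eq_sum_range (fun g => f (lev k g) * f (lev k' (L - g))),
    ← Fin.sum_univ_eq_sum_range (fun g => f (lev (fun i => k i + k' i - N) g) * f (lev (fun _ => N) (L - g)))]
  calc ∑ g : Fin (L + 1), f (lev k g) * f (lev k' (L - g))
      ≤ ∑ g : Fin (L + 1), Psi f (nuL k k' L g) := sum_le_sum fun g _ => mul_le_Psi_nuL hfl k k' L g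
    _ ≤ ∑ g : Fin (L + 1), Psi f (nuR k k' N L g) :=
        Lorentz.sum_le_sum_of_chain_of_cnt_le (Psi_supermod hf0 hfm hfl) (Psi_mono hf0 hfm) _ _
          (nuR_chain k k' N L) (cnt_nuL_le_cnt_nuR k k' N L hk hk' hkk')
    _ = ∑ g : Fin (L + 1), f (lev (fun i => k i + k' i - N) g) * f (lev (fun _ => N) (L - g)) :=
        sum_congr rfl fun g _ => Psi_nuR_eq f k k' N L hkk' g

end LSM

end Summit.CriticalPhenomena.PercolationContinuityZ3.Theorems.SunflowerPartition
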